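import Literature.MathematicalPhysics.QuantumFieldTheory.Balaban1983to89.B5Hk163RDiv

/-!
# Bałaban 1984 (Propagators I), Sect. D p.27–28: the operator `φ = Q_kΔ⁻¹Q_k*` (1.58) on the
double torus and its momentum representation (1.62)

T. Bałaban, *Propagators and renormalization transformations for lattice gauge theories. I*,
Commun. Math. Phys. **95** (1984) 17–40, Sect. D «The case of τ = 1 (the δ-function constraint)»,
p.27 (1.58) and p.28 (1.61)–(1.62).  Quotations below are read from the page images
(`1984-cmp95-propagators-rt-I-p011/p012`), not from OCR.

PRINTED (p.27, after the solvability condition «which is equivalent to ∂₁*ω = 0»):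
«Let us introduce the operator
  φ = Q_kΔ⁻¹Q_k*.                                                                    (1.58)
Equation (1.57) can be solved with respect to ω and we get ω = + φ⁻¹∂₁λ′ − φ⁻¹B′.»
and (p.28) «Let us write this operator in momentum representation.
  (Q_kA)~_μ(p′) = Σ_l u(p′+l) v_μ(p′+l) Ã_μ(p′+l),  v_μ(p) = ∂¹_μ(p′)/∂_μ(p),            (1.61)
and operator φ as
  (φω)~_μ(p′) = φ_μ(p′) ω̃_μ(p′),  φ_μ(p′) = Σ_l |u(p′+l)|² |v_μ(p′+l)|² / Δ(p′+l),        (1.62)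
where we have omitted the subscript k. Multiplying φ_μ(p′) by Δ₀(p′), we get a well-defined
positive function for all p′ ∈ T̃₁^{(k)}, 0 < γ₀ ≦ Δ₀(p′)φ_μ(p′) ≦ γ₁.»

WHAT THIS FILE DOES (kernel-checked bookkeeping on the finite double torus
`T_η = Tor (fine n M)`, `T₁^{(k)} = Tor M`, `n = L^k`, lattice constant `c = n` as everywhere in
the B5 tree modules; NOT summit progress):

* §1 `liftV`: the componentwise («diagonal in the vector index μ») lift of scalar torus operators
  to vector fields, with `comp N (liftV N L *ᵥ A) κ = L κ *ᵥ comp N A κ`.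
* §2 `LapVinv n M` = the componentwise `Δ⁻¹` (`B5LaplaceInverse.LapSinv (fine n M) n`, the
  Fourier multiplier `Δ(p)⁻¹` with value `0` on constants), and THE TYPED (1.58)
  `PhiOp n M := QvOp n M * LapVinv n M * QvAdj n M`, where `QvOp` is the typed `Q_k` of
  (1.18)/(1.61) (`B5Block118`) and `QvAdj = n^d • (QvOp)ᴴ` is its adjoint for the scalar products
  (1.21) (`B5DeltaA169.QvAdj`, fixed by (1.74)).
* §3 THE PRINTED (1.62) PROVED for this operator: `dft_PhiOp`
  `(dft M *ᵥ comp M (PhiOp n M *ᵥ B) μ) q = φ_μ(sOf q) · (dft M *ᵥ comp M B μ) q` for EVERY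
  coarse momentum `q` (at `q = 0` both sides carry the factor `φ_μ(0) = 0`, §4), where
  `φ_μ = B5Bounds167Lattice.phi162 n μ` is pass pv15's verbatim typing of the printed
  `Σ_l |u(p′+l)|²|v_μ(p′+l)|²/Δ(p′+l)`.  The proof is the composition of the tree's momentum
  representations: (1.61) `B5Block118.dft_QvOp`, `B5Momentum133.dft_LapSinv_apply`
  (`(Δ⁻¹f)~ = Δ⁻¹f̃`), `B5Adjoint176.dft_QvOp_adjoint` (`(Q_kᴴB)~(p′+l) = c·conj(u v_μ)·B̃(p′)`),
  the coset identity `B5Momentum133.lsym_pOf` (`Δ(p′+l) = DeltaXir n 0 (shiftr l (sOf p′))`) and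
  the normalisation identity `c_Q² · n^d = 1` (`cQ_sq_mul_pow`) — the latter is exactly what makes
  the (1.21)-adjoint `QvAdj` (rather than the plain conjugate transpose) reproduce the printed
  multiplier with no extra constant.
* §4 the zero mode: `phi162 n μ 0 = 0` (the `l = 0` term is `|u|²|v|²/Δ(0)` with `Δ(0) = 0`, value
  `0` by Lean's `x/0 = 0` inside pv15's REAL sum `phi162` (`div_zero`) — which coincides with the
  `Δ⁻¹`-on-constants convention of the tree (`B5LaplaceInverse.linv = 0` where `Δ = 0`), so both
  readings agree (v1.1); the `l ≠ 0` terms vanish because `u(l) = 0`, `B5FiberZero.uSym_zero`),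
  hence `PhiOp` maps every field into the subspace orthogonal to constants
  (`orthConst_PhiOp_mulVec`) and annihilates the constant configurations `B₀`
  (`PhiOp_mulVec_const`, via `dft_const_of_ne`: a constant has no non-zero Fourier modes), and
  `φ_μ(sOf q) ≠ 0` for `q ≠ 0` (pv15 `B5Action165Lagrange.phi162_pos`, the printed
  «0 < γ₀ ≦ Δ₀φ_μ»).
* §5 THE PRINTED `φ⁻¹` of «ω = φ⁻¹∂₁λ′ − φ⁻¹B′» on the subspace `{B′}` orthogonal to constants:
  `PhiInv n M` (the coarse componentwise multiplier `φ_μ(p′)⁻¹`, value `0` at `p′ = 0`) with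
  `PhiOp_PhiInv_of_orthConst : PhiOp *ᵥ (PhiInv *ᵥ B′) = B′` and
  `PhiInv_PhiOp_of_orthConst : PhiInv *ᵥ (PhiOp *ᵥ B′) = B′` for `B′ ⊥ constants` — the concrete
  torus form of the law «φφ⁻¹ = I on {B − B₀}» that pass pv15's abstract `B5HkProperties.Laws`
  takes as a hypothesis (`h158`); and the unique solvability of `φω = B′` among `ω ⊥ constants`
  (`PhiOp_mulVec_eq_iff`, the printed «Equation (1.57) can be solved with respect to ω»).

Schematic choices (DIVERGENCE): finite double torus instead of the printed `T_η`/`T₁^{(k)}` with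
`L′_μ → ∞` limits; the unitary DFT `B5Prop11Plancherel.dft` (normalisation constants do not
affect (1.62), see `B5Block118.dft_QvOp`); `Δ⁻¹` = the Fourier multiplier with value `0` on the
zero mode (`B5LaplaceInverse.linv`), which is the printed `Δ⁻¹` on the subspace orthogonal to
constants where Sect. D uses it (p.27 «A′ is orthogonal to constant functions also»).

v1.1 (lineage b05 gen 13; DOCSTRING-ONLY, no declaration changed): cross-read D1 (adv6) — the two
zero-mode docstrings (§4 bullet above, `phi162_zero`) now say that the value `0` of the `l = 0` term at
`p′ = 0` comes from Lean's division convention inside the real sum `phi162`, and that this coincides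
with the `linv` convention of the operator `Δ⁻¹`.
-/

open scoped BigOperators Matrix ComplexConjugate
open Finset Complex

namespace Literature.MathematicalPhysics.QuantumFieldTheory.Balaban1983to89.B5Phi162Torus

open Literature.MathematicalPhysics.QuantumFieldTheory.Balaban1983to89.B4Strip (shiftr DeltaXir)
open Literature.MathematicalPhysics.QuantumFieldTheory.Balaban1983to89.B5Action165Lagrange (phi162_pos)
open Literature.MathematicalPhysics.QuantumFieldTheory.Balaban1983to89.B5Prop11Plancherel (Tor dft fine sOf
  abs_sOf_le sOf_ne_zero sOf_zero Delta_zero_zero chi sum_chi)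
open Literature.MathematicalPhysics.QuantumFieldTheory.Balaban1983to89.B5Prop11Fiber (vSym uSym)
open Literature.MathematicalPhysics.QuantumFieldTheory.Balaban1983to89.B5Action121 (comp)
open Literature.MathematicalPhysics.QuantumFieldTheory.Balaban1983to89.B5Block118 (pOf cQ cQ_eq cT QvOp
  dft_QvOp dft_apply')
open Literature.MathematicalPhysics.QuantumFieldTheory.Balaban1983to89.B5Constraint130 (cQ_ne_zero)
open Literature.MathematicalPhysics.QuantumFieldTheory.Balaban1983to89.B5Hk163Torus (dft_mulVec_injective)
open Literature.MathematicalPhysics.QuantumFieldTheory.Balaban1983to89.B5Bounds167Lattice (phi162 phi162_nonneg)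
open Literature.MathematicalPhysics.QuantumFieldTheory.Balaban1983to89.B5LaplaceInverse (lsym linv LapSinv
  dft_mul_conjTranspose LapSinv_conjTranspose)
open Literature.MathematicalPhysics.QuantumFieldTheory.Balaban1983to89.B5Momentum130 (dft_zero_apply)
open Literature.MathematicalPhysics.QuantumFieldTheory.Balaban1983to89.B5Momentum133 (lsym_pOf lsym_pOf_ne_zero
  dft_LapSinv_apply)
open Literature.MathematicalPhysics.QuantumFieldTheory.Balaban1983to89.B5DeltaA169 (QvAdj QvAdj_mulVec)
open Literature.MathematicalPhysics.QuantumFieldTheory.Balaban1983to89.B5Adjoint176 (dft_QvOp_adjoint)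
open Literature.MathematicalPhysics.QuantumFieldTheory.Balaban1983to89.B5FiberZero (uSym_zero)

noncomputable section

variable {d : ℕ}

/-! ## §1 Componentwise lift of scalar torus operators to vector fields -/

section Lift

variable (N : Fin d → ℕ) [hN : ∀ ν, NeZero (N ν)]

/-- the operator acting as `L μ` on the component `A_μ` of a vector field (diagonal in the vector
index; the shape of every Fourier-multiplier operator of Sect. D: `Δ⁻¹`, `φ`, `φ⁻¹`). [folklore] -/
def liftV (L : Fin d → Matrix (Tor N) (Tor N) ℂ) : Matrix (Tor N × Fin d) (Tor N × Fin d) ℂ :=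
  fun i j => if i.2 = j.2 then L i.2 i.1 j.1 else 0

/-- `(liftV L A)_κ = L_κ A_κ` componentwise. [folklore] -/
theorem comp_liftV_mulVec (L : Fin d → Matrix (Tor N) (Tor N) ℂ) (A : Tor N × Fin d → ℂ) (κ : Fin d) :
    comp N (liftV N L *ᵥ A) κ = L κ *ᵥ comp N A κ := by
  funext x
  show (liftV N L *ᵥ A) (x, κ) = (L κ *ᵥ fun y => A (y, κ)) x
  simp only [Matrix.mulVec, dotProduct, liftV, Fintype.sum_prod_type, ite_mul, zero_mul,
    Finset.sum_ite_eq, Finset.mem_univ, if_true]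

omit hN in
/-- components: `(c • A)_κ = c • A_κ`. [folklore] -/
theorem comp_smul (c : ℂ) (A : Tor N × Fin d → ℂ) (κ : Fin d) : comp N (c • A) κ = c • comp N A κ :=
  rfl

omit hN in
/-- a vector field is determined by its components. [folklore] -/
theorem eq_of_comp_eq {A A' : Tor N × Fin d → ℂ} (h : ∀ κ, comp N A κ = comp N A' κ) : A = A' := by
  funext ⟨y, κ⟩
  exact congrFun (h κ) y

/-- «B′ is in the orthogonal subspace» (to the constant configurations, componentwise):
`Σ_y B_μ(y) = 0` for every `μ`. [cite: Balaban1984PropagatorsI, p.27 before (1.58)] -/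
def OrthConst (B : Tor N × Fin d → ℂ) : Prop := ∀ μ, ∑ y, B (y, μ) = 0

/-- for `B ⊥ constants` the zero Fourier mode of every component vanishes: `B̃_μ(0) = 0`.
[folklore] -/
theorem dft_comp_zero_of_orthConst {B : Tor N × Fin d → ℂ} (hB : OrthConst N B) (μ : Fin d) :
    (dft N *ᵥ comp N B μ) 0 = 0 := by
  rw [dft_zero_apply]
  show (cT N : ℂ) * ∑ y, B (y, μ) = 0
  rw [hB μ, mul_zero]

/-- conversely `B̃_μ(0) = 0` for all `μ` means `B ⊥ constants`. [folklore] -/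
theorem orthConst_of_dft_comp_zero {B : Tor N × Fin d → ℂ} (h : ∀ μ, (dft N *ᵥ comp N B μ) 0 = 0) :
    OrthConst N B := by
  intro μ
  have h1 := h μ
  rw [dft_zero_apply] at h1
  have hc : (cT N : ℂ) ≠ 0 := by
    have : (0 : ℝ) < cT N := by unfold cT; positivity
    exact_mod_cast this.ne'
  exact (mul_eq_zero.mp h1).resolve_left hc

/-- the Fourier transform of a CONSTANT function is supported on the zero mode: `ã(q) = 0` for
`q ≠ 0`. [folklore] -/
theorem dft_const_of_ne (a : ℂ) {q : Tor N} (hq : q ≠ 0) : (dft N *ᵥ fun _ : Tor N => a) q = 0 := by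
  simp only [Matrix.mulVec, dotProduct, dft_apply']
  rw [← Finset.sum_mul, ← Finset.mul_sum, ← map_sum, sum_chi, if_neg hq, map_zero, mul_zero, zero_mul]

/-- a coarse componentwise FOURIER MULTIPLIER operator: `(cMul m B)~_μ(q) = m_μ(q) B̃_μ(q)`.
[folklore] -/
def cMul (m : Fin d → Tor N → ℂ) : Matrix (Tor N × Fin d) (Tor N × Fin d) ℂ :=
  liftV N fun μ => (dft N)ᴴ * Matrix.diagonal (m μ) * dft N

/-- `(cMul m B)~_μ(q) = m_μ(q) · B̃_μ(q)`. [folklore] -/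
theorem dft_cMul (m : Fin d → Tor N → ℂ) (B : Tor N × Fin d → ℂ) (μ : Fin d) (q : Tor N) :
    (dft N *ᵥ comp N (cMul N m *ᵥ B) μ) q = m μ q * (dft N *ᵥ comp N B μ) q := by
  rw [cMul, comp_liftV_mulVec, Matrix.mulVec_mulVec, ← Matrix.mul_assoc, ← Matrix.mul_assoc,
    dft_mul_conjTranspose, Matrix.one_mul, ← Matrix.mulVec_mulVec, Matrix.mulVec_diagonal]

end Lift

variable (n : ℕ) [NeZero n] (M : Fin d → ℕ) [hM : ∀ μ, NeZero (M μ)]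

/-! ## §2 (1.58): `Δ⁻¹` on vector fields and `φ = Q_kΔ⁻¹Q_k*` -/

/-- `Δ⁻¹` acting componentwise on vector fields on `T_η` (Fourier multiplier `Δ(p)⁻¹`, value `0`
on the constant mode). [cite: Balaban1984PropagatorsI, p.22, p.27 «A′ is orthogonal to constant
functions also», (1.58) p.27] -/
def LapVinv : Matrix (Tor (fine n M) × Fin d) (Tor (fine n M) × Fin d) ℂ :=
  liftV (fine n M) fun _ => LapSinv (fine n M) (n : ℂ)

/-- `(Δ⁻¹A)_κ = Δ⁻¹(A_κ)`. [folklore] -/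
theorem comp_LapVinv_mulVec (A : Tor (fine n M) × Fin d → ℂ) (κ : Fin d) :
    comp (fine n M) (LapVinv n M *ᵥ A) κ = LapSinv (fine n M) (n : ℂ) *ᵥ comp (fine n M) A κ :=
  comp_liftV_mulVec (fine n M) _ A κ

/-- **(1.58) TYPED**: «φ = Q_kΔ⁻¹Q_k*», with `Q_k = QvOp n M` ((1.18)/(1.61)) and `Q_k*` its adjoint
for the scalar products (1.21), `QvAdj n M = n^d • (QvOp n M)ᴴ`.
[cite: Balaban1984PropagatorsI, (1.58) p.27] -/
def PhiOp : Matrix (Tor M × Fin d) (Tor M × Fin d) ℂ := QvOp n M * LapVinv n M * QvAdj n M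

/-- `φB = Q_k(Δ⁻¹(Q_k*B))`. [cite: Balaban1984PropagatorsI, (1.58) p.27] -/
theorem PhiOp_mulVec (B : Tor M × Fin d → ℂ) :
    PhiOp n M *ᵥ B = QvOp n M *ᵥ (LapVinv n M *ᵥ (QvAdj n M *ᵥ B)) := by
  rw [PhiOp, ← Matrix.mulVec_mulVec, ← Matrix.mulVec_mulVec]

/-! ## §3 (1.62): the momentum representation of `φ` -/

/-- the normalisation identity `c_Q² · n^d = 1` (`c_Q = (√(n^d))⁻¹`, `B5Block118.cQ_eq`). [folklore] -/
theorem cQ_sq_mul_pow : ((cQ n M : ℂ)) ^ 2 * ((n : ℂ)) ^ d = 1 := by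
  have h0 : (0 : ℝ) ≤ ((n : ℝ)) ^ d := by positivity
  have hne : ((n : ℝ)) ^ d ≠ 0 := pow_ne_zero _ (by exact_mod_cast NeZero.ne n)
  have h : (cQ n M) ^ 2 * ((n : ℝ)) ^ d = 1 := by
    rw [cQ_eq, inv_pow, Real.sq_sqrt h0, inv_mul_cancel₀ hne]
  exact_mod_cast h

/-- the `Δ⁻¹Q_k*`-part on the coset `p′ + l`:
`(Δ⁻¹Q_k*B)~_μ(p′+l) = Δ(p′+l)⁻¹ · n^d · c_Q · conj(u(p′+l)v_μ(p′+l)) · B̃_μ(p′)`.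
[cite: Balaban1984PropagatorsI, (1.58) p.27, (1.61)–(1.62) p.28] -/
theorem dft_LapVinv_QvAdj (B : Tor M × Fin d → ℂ) (k : Fin d → Fin n) (q : Tor M) (μ : Fin d) :
    (dft (fine n M) *ᵥ comp (fine n M) (LapVinv n M *ᵥ (QvAdj n M *ᵥ B)) μ) (pOf n M (k, q))
      = (lsym (fine n M) (n : ℂ) (pOf n M (k, q)))⁻¹ *
          (((n : ℂ)) ^ d * ((cQ n M : ℂ) * conj (uSym n k (sOf M q) * vSym n k (sOf M q) μ)
            * (dft M *ᵥ comp M B μ) q)) := by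
  rw [comp_LapVinv_mulVec, dft_LapSinv_apply, QvAdj_mulVec, comp_smul, Matrix.mulVec_smul,
    Pi.smul_apply, smul_eq_mul, dft_QvOp_adjoint]

/-- **(1.62) PROVED for the typed (1.58)**: «(φω)~_μ(p′) = φ_μ(p′)ω̃_μ(p′),
φ_μ(p′) = Σ_l |u(p′+l)|²|v_μ(p′+l)|²/Δ(p′+l)» — for every coarse momentum `p′ ↔ q` (including
`q = 0`, where `φ_μ(0) = 0`, `phi162_zero`), with `φ_μ = B5Bounds167Lattice.phi162 n μ` at
`p′ = sOf q`. [cite: Balaban1984PropagatorsI, (1.62) p.28] -/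
theorem dft_PhiOp (B : Tor M × Fin d → ℂ) (q : Tor M) (μ : Fin d) :
    (dft M *ᵥ comp M (PhiOp n M *ᵥ B) μ) q
      = ((phi162 n μ (sOf M q) : ℝ) : ℂ) * (dft M *ᵥ comp M B μ) q := by
  rw [PhiOp_mulVec, dft_QvOp]
  simp_rw [dft_LapVinv_QvAdj]
  rw [phi162, Complex.ofReal_sum, Finset.sum_mul, Finset.mul_sum]
  refine Finset.sum_congr rfl fun k _ => ?_
  rw [lsym_pOf]
  have hc := cQ_sq_mul_pow n M
  set w : ℂ := uSym n k (sOf M q) * vSym n k (sOf M q) μ with hw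
  set D : ℝ := DeltaXir n 0 (shiftr n k (sOf M q)) with hD
  set b : ℂ := (dft M *ᵥ comp M B μ) q with hb
  calc (cQ n M : ℂ) * (w * (((D : ℝ) : ℂ)⁻¹ * (((n : ℂ)) ^ d * ((cQ n M : ℂ) * conj w * b))))
      = (((cQ n M : ℂ)) ^ 2 * ((n : ℂ)) ^ d) * (w * conj w) * ((D : ℝ) : ℂ)⁻¹ * b := by ring
    _ = ((‖w‖ ^ 2 : ℝ) : ℂ) * ((D : ℝ) : ℂ)⁻¹ * b := by
        rw [hc, one_mul, Complex.mul_conj', Complex.ofReal_pow]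
    _ = ((‖uSym n k (sOf M q)‖ ^ 2 * ‖vSym n k (sOf M q) μ‖ ^ 2 / D : ℝ) : ℂ) * b := by
        rw [hw, norm_mul, mul_pow]
        push_cast
        ring

/-- (1.62) as an identity of functions of `p′`: `(φB)~_μ = φ_μ · B̃_μ`.
[cite: Balaban1984PropagatorsI, (1.62) p.28] -/
theorem dft_comp_PhiOp (B : Tor M × Fin d → ℂ) (μ : Fin d) :
    dft M *ᵥ comp M (PhiOp n M *ᵥ B) μ
      = fun q => ((phi162 n μ (sOf M q) : ℝ) : ℂ) * (dft M *ᵥ comp M B μ) q :=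
  funext fun q => dft_PhiOp n M B q μ

/-- `φ` IS the coarse Fourier multiplier `φ_μ(p′)`: `φB = cMul (φ_μ ∘ sOf) B`. [folklore] -/
theorem PhiOp_mulVec_eq_cMul (B : Tor M × Fin d → ℂ) :
    PhiOp n M *ᵥ B = cMul M (fun μ q => ((phi162 n μ (sOf M q) : ℝ) : ℂ)) *ᵥ B := by
  refine eq_of_comp_eq M fun μ => dft_mulVec_injective M ?_
  funext q
  show (dft M *ᵥ comp M (PhiOp n M *ᵥ B) μ) q = (dft M *ᵥ comp M (cMul M _ *ᵥ B) μ) q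
  rw [dft_PhiOp, dft_cMul]

/-! ## §4 The zero mode and positivity of `φ_μ` -/

omit hM in
/-- `φ_μ(0) = 0`: at `p′ = 0` the `l = 0` term is `1·1/Δ(0)` with `Δ(0) = 0` — value `0` by Lean's
`x/0 = 0` inside the real sum `phi162` (`div_zero`), which coincides with the convention `linv = 0`
where `Δ = 0` of the tree's `Δ⁻¹` (v1.1) — and the `l ≠ 0` terms vanish since «u_k(l) = 0 for l ≠ 0»
(p.23). [cite: Balaban1984PropagatorsI, (1.62) p.28, p.23] -/
theorem phi162_zero (hn : 1 ≤ n) (μ : Fin d) : phi162 n μ (0 : Fin d → ℝ) = 0 := by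
  unfold phi162
  refine Finset.sum_eq_zero fun k _ => ?_
  by_cases hk : k = 0
  · subst hk
    have h0 : DeltaXir n 0 (shiftr n (0 : Fin d → Fin n) 0) = 0 := Delta_zero_zero n
    rw [h0, div_zero]
  · rw [uSym_zero n hn k, if_neg hk, norm_zero, zero_pow two_ne_zero, zero_mul, zero_div]

/-- `(φB)~_μ(0) = 0` for every `B`. [folklore] -/
theorem dft_PhiOp_zero (hn : 1 ≤ n) (B : Tor M × Fin d → ℂ) (μ : Fin d) :
    (dft M *ᵥ comp M (PhiOp n M *ᵥ B) μ) 0 = 0 := by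
  rw [dft_PhiOp, sOf_zero, phi162_zero n hn, Complex.ofReal_zero, zero_mul]

/-- `φ` maps every field into the subspace orthogonal to constants (`Σ_y (φB)_μ(y) = 0`).
[cite: Balaban1984PropagatorsI, p.27 (1.57)–(1.58)] -/
theorem orthConst_PhiOp_mulVec (hn : 1 ≤ n) (B : Tor M × Fin d → ℂ) :
    OrthConst M (PhiOp n M *ᵥ B) :=
  orthConst_of_dft_comp_zero M fun μ => dft_PhiOp_zero n M hn B μ

/-- `φ` ANNIHILATES THE CONSTANT CONFIGURATIONS `B₀` (so `φB = φB′` for the printed decomposition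
«B = B′ + B₀, where B₀ is a constant configuration and B′ is in the orthogonal subspace»; `φ⁻¹` is
only ever applied to `B′`). [cite: Balaban1984PropagatorsI, p.27 before (1.58)] -/
theorem PhiOp_mulVec_const (hn : 1 ≤ n) (c : Fin d → ℂ) :
    PhiOp n M *ᵥ (fun i : Tor M × Fin d => c i.2) = 0 := by
  refine eq_of_comp_eq M fun μ => dft_mulVec_injective M ?_
  funext q
  show (dft M *ᵥ comp M (PhiOp n M *ᵥ fun i : Tor M × Fin d => c i.2) μ) q
    = (dft M *ᵥ comp M (0 : Tor M × Fin d → ℂ) μ) q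
  have h0 : comp M (0 : Tor M × Fin d → ℂ) μ = 0 := rfl
  rw [dft_PhiOp, h0, Matrix.mulVec_zero, Pi.zero_apply]
  by_cases hq : q = 0
  · subst hq
    rw [sOf_zero, phi162_zero n hn, Complex.ofReal_zero, zero_mul]
  · have hc : comp M (fun i : Tor M × Fin d => c i.2) μ = fun _ => c μ := rfl
    rw [hc, dft_const_of_ne M (c μ) hq, mul_zero]

/-- `φ_μ(p′) ≠ 0` for `p′ ≠ 0` on the Brillouin zone («we get a well-defined positive function …
0 < γ₀ ≦ Δ₀(p′)φ_μ(p′)», pv15 `B5Action165Lagrange.phi162_pos`).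
[cite: Balaban1984PropagatorsI, p.28 after (1.62)] -/
theorem phi162_sOf_ne_zero (hn : 1 ≤ n) (μ : Fin d) {q : Tor M} (hq : q ≠ 0) :
    phi162 n μ (sOf M q) ≠ 0 := by
  obtain ⟨ν₀, hν₀⟩ := Function.ne_iff.mp (sOf_ne_zero M hq)
  exact (phi162_pos n hn μ (sOf M q) (fun ν => abs_sOf_le M q ν) ν₀ hν₀).ne'

/-- `φ_μ(p′) > 0` for `p′ ≠ 0`. [cite: Balaban1984PropagatorsI, p.28 after (1.62)] -/
theorem phi162_sOf_pos (hn : 1 ≤ n) (μ : Fin d) {q : Tor M} (hq : q ≠ 0) :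
    0 < phi162 n μ (sOf M q) :=
  lt_of_le_of_ne (phi162_nonneg n μ _) (phi162_sOf_ne_zero n M hn μ hq).symm

/-! ## §5 The printed `φ⁻¹` on the subspace orthogonal to constants -/

/-- `φ⁻¹` («ω = + φ⁻¹∂₁λ′ − φ⁻¹B′», `B′ ⊥ constants`): the coarse componentwise Fourier multiplier
`φ_μ(p′)⁻¹` (value `0` at `p′ = 0`, where `φ_μ(0) = 0`).
[cite: Balaban1984PropagatorsI, (1.58) p.27, (1.62) p.28] -/
def PhiInv : Matrix (Tor M × Fin d) (Tor M × Fin d) ℂ :=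
  cMul M fun μ q => (((phi162 n μ (sOf M q) : ℝ) : ℂ))⁻¹

omit [NeZero n] in
/-- `(φ⁻¹B)~_μ(p′) = φ_μ(p′)⁻¹ B̃_μ(p′)`. [cite: Balaban1984PropagatorsI, (1.62) p.28] -/
theorem dft_PhiInv (B : Tor M × Fin d → ℂ) (q : Tor M) (μ : Fin d) :
    (dft M *ᵥ comp M (PhiInv n M *ᵥ B) μ) q
      = (((phi162 n μ (sOf M q) : ℝ) : ℂ))⁻¹ * (dft M *ᵥ comp M B μ) q :=
  dft_cMul M _ B μ q

/-- **`φφ⁻¹ = I` on the subspace orthogonal to constants**: `φ(φ⁻¹B′) = B′` for `B′ ⊥ constants`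
(the law «φφ⁻¹ = I on {B − B₀}» behind «Equation (1.57) can be solved with respect to ω»).
[cite: Balaban1984PropagatorsI, (1.57)–(1.58) p.27, (1.62) p.28] -/
theorem PhiOp_PhiInv_of_orthConst (hn : 1 ≤ n) {B : Tor M × Fin d → ℂ} (hB : OrthConst M B) :
    PhiOp n M *ᵥ (PhiInv n M *ᵥ B) = B := by
  refine eq_of_comp_eq M fun μ => dft_mulVec_injective M ?_
  funext q
  show (dft M *ᵥ comp M (PhiOp n M *ᵥ (PhiInv n M *ᵥ B)) μ) q = (dft M *ᵥ comp M B μ) q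
  rw [dft_PhiOp, dft_PhiInv]
  by_cases hq : q = 0
  · subst hq
    rw [dft_comp_zero_of_orthConst M hB μ, mul_zero, mul_zero]
  · have hφ : ((phi162 n μ (sOf M q) : ℝ) : ℂ) ≠ 0 := by
      exact_mod_cast phi162_sOf_ne_zero n M hn μ hq
    rw [← mul_assoc, mul_inv_cancel₀ hφ, one_mul]

/-- **`φ⁻¹φ = I` on the subspace orthogonal to constants**: `φ⁻¹(φB′) = B′` for `B′ ⊥ constants`.
[cite: Balaban1984PropagatorsI, (1.57)–(1.58) p.27, (1.62) p.28] -/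
theorem PhiInv_PhiOp_of_orthConst (hn : 1 ≤ n) {B : Tor M × Fin d → ℂ} (hB : OrthConst M B) :
    PhiInv n M *ᵥ (PhiOp n M *ᵥ B) = B := by
  refine eq_of_comp_eq M fun μ => dft_mulVec_injective M ?_
  funext q
  show (dft M *ᵥ comp M (PhiInv n M *ᵥ (PhiOp n M *ᵥ B)) μ) q = (dft M *ᵥ comp M B μ) q
  rw [dft_PhiInv, dft_PhiOp]
  by_cases hq : q = 0
  · subst hq
    rw [dft_comp_zero_of_orthConst M hB μ, mul_zero, mul_zero]
  · have hφ : ((phi162 n μ (sOf M q) : ℝ) : ℂ) ≠ 0 := by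
      exact_mod_cast phi162_sOf_ne_zero n M hn μ hq
    rw [← mul_assoc, inv_mul_cancel₀ hφ, one_mul]

/-- `φ⁻¹` also maps into the subspace orthogonal to constants. [folklore] -/
theorem orthConst_PhiInv_mulVec (hn : 1 ≤ n) (B : Tor M × Fin d → ℂ) :
    OrthConst M (PhiInv n M *ᵥ B) :=
  orthConst_of_dft_comp_zero M fun μ => by
    rw [dft_PhiInv, sOf_zero, phi162_zero n hn, Complex.ofReal_zero, inv_zero, zero_mul]

/-- UNIQUE SOLVABILITY of `φω = B′` in the subspace orthogonal to constants («Equation (1.57) can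
be solved with respect to ω»): for `B′ ⊥ constants`, `ω ⊥ constants` solves `φω = B′` iff
`ω = φ⁻¹B′`. [cite: Balaban1984PropagatorsI, (1.57)–(1.58) p.27] -/
theorem PhiOp_mulVec_eq_iff (hn : 1 ≤ n) {B ω : Tor M × Fin d → ℂ} (hB : OrthConst M B)
    (hω : OrthConst M ω) : PhiOp n M *ᵥ ω = B ↔ ω = PhiInv n M *ᵥ B := by
  constructor
  · intro h
    rw [← h, PhiInv_PhiOp_of_orthConst n M hn hω]
  · intro h
    rw [h, PhiOp_PhiInv_of_orthConst n M hn hB]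

end

end Literature.MathematicalPhysics.QuantumFieldTheory.Balaban1983to89.B5Phi162Torus
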